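import Mathlib

/-!
# `DivisionGap.PerMultiplesHard` (stmt-ValiantsHypothesis-5068), line `uncharged-face-walk`:
type rigidity of `Z`-probes (stub `stub_zRigidity`)

Pure finite combinatorics on permutations of `Fin n`.  Fix a set `Z` of `k` permutations of
`Fin n` (the probe shifts).  For `S, T ⊆ Fin n` with `#S = s` in the window `n < 3ks ≤ 2n`, call
a permutation `π` COMPATIBLE with `(S, T)` when
(a) every `i ∈ S` has `π⁻¹ (ζ i) ∈ T` for some `ζ ∈ Z`, and (b) every `j ∈ T` has `π j = ζ i`
for some `ζ ∈ Z` and `i ∈ S`.  Then `#compatible · 3^{⌊n/(3k²)⌋} ≤ 2^{⌊n/(3k²)⌋} · n!`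
(`stub_zRigidity`; the case `Z = {1, ζ}` is the spread-rigidity lemma of the sibling module
`DivisionGapPerMultiplesHardStubSpreadRigidity`, whose proof is adapted here).

Proof.  Compatibility depends on `π` only through `U := π(T)`: (b) says
`U ⊆ W := ⋃_{i ∈ S} {ζ i | ζ ∈ Z}` (`#W ≤ ks`) and (a) says every `i ∈ S` has `ζ i ∈ U` for some
`ζ ∈ Z`.  So the compatible set is covered by the fibres `{π | π(T) = U}` over the valid `U` (all
of size `u := #T`); each fibre has at most `u! (n-u)!` elements (restrict `π` to injections
`T ↪ U` and `Tᶜ ↪ Uᶜ`); there are at most `C(ks, u)` valid `U`; and a valid `U` covers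
`S ⊆ ⋃_{x ∈ U} {ζ⁻¹ x | ζ ∈ Z}`, so `s ≤ ku`, whence `n < 3ks ≤ 3k²u` and `⌊n/(3k²)⌋ < u`.
Finally `C(ks,u) u! (n-u)! 3^f ≤ 2^f n!` for `f ≤ u` because
`(ks)(ks-1)⋯(ks-u+1) · 3^f ≤ 2^f · n(n-1)⋯(n-u+1)` termwise (`3(ks-l) ≤ 2(n-l)` as `3ks ≤ 2n`
for the first `f` factors, `ks - l ≤ n - l` for the rest).
-/

set_option linter.dupNamespace false

namespace Summit.ValiantsHypothesis.ValiantsHypothesis.Theorems.DivisionGap.PerMultiplesHard.ZRigidity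

open scoped NNReal BigOperators

-- adapted from DivisionGapPerMultiplesHardStubSpreadRigidity.lean (p103668)
/-- Descending-factorial ratio bound: if `3a ≤ 2b` then
`a(a-1)⋯(a-u+1) · 3^f ≤ 2^f · b(b-1)⋯(b-u+1)` for every `f ≤ u`. [folklore] -/
theorem descFactorial_mul_three_pow_le (a b : ℕ) (hab : 3 * a ≤ 2 * b) :
    ∀ u f : ℕ, f ≤ u → a.descFactorial u * 3 ^ f ≤ 2 ^ f * b.descFactorial u := by
  intro u
  induction u with
  | zero =>
    intro f hf
    obtain rfl : f = 0 := Nat.le_zero.mp hf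
    simp
  | succ u ih =>
    intro f hf
    rcases Nat.lt_or_ge u f with h | h
    · obtain rfl : f = u + 1 := le_antisymm hf h
      have key := ih u le_rfl
      have h2 : (a - u) * 3 ≤ 2 * (b - u) := by omega
      rw [Nat.descFactorial_succ, Nat.descFactorial_succ, pow_succ, pow_succ]
      calc (a - u) * a.descFactorial u * (3 ^ u * 3)
          = ((a - u) * 3) * (a.descFactorial u * 3 ^ u) := by ring
        _ ≤ (2 * (b - u)) * (2 ^ u * b.descFactorial u) := Nat.mul_le_mul h2 key
        _ = 2 ^ u * 2 * ((b - u) * b.descFactorial u) := by ring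
    · have key := ih f h
      have h2 : a - u ≤ b - u := by omega
      rw [Nat.descFactorial_succ, Nat.descFactorial_succ]
      calc (a - u) * a.descFactorial u * 3 ^ f
          = (a - u) * (a.descFactorial u * 3 ^ f) := by ring
        _ ≤ (b - u) * (2 ^ f * b.descFactorial u) := Nat.mul_le_mul h2 key
        _ = 2 ^ f * ((b - u) * b.descFactorial u) := by ring

-- adapted (generalised from `Fin n` to a finite type) from
-- DivisionGapPerMultiplesHardStubSpreadRigidity.lean (p103668), which is not imported here
/-- Fibre bound: the permutations of a finite type `α` mapping `T` onto a set `U` of the same size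
number at most `#T ! · (#α - #T)!` (restriction gives an injection into `(T ↪ U) × (Tᶜ ↪ Uᶜ)`).
[folklore] -/
theorem card_perm_filter_image_eq_le {α : Type*} [Fintype α] [DecidableEq α] (T U : Finset α)
    (hU : U.card = T.card) :
    ((Finset.univ : Finset (Equiv.Perm α)).filter
        fun π : Equiv.Perm α => T.image ⇑π = U).card ≤
      T.card.factorial * (Fintype.card α - T.card).factorial := by
  classical
  set F := (Finset.univ : Finset (Equiv.Perm α)).filter
    fun π : Equiv.Perm α => T.image ⇑π = U with hF
  have key : ∀ π : Equiv.Perm α, π ∈ F → ∀ x, x ∈ T ↔ π x ∈ U := by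
    intro π hπ x
    rw [hF, Finset.mem_filter] at hπ
    rw [← hπ.2, Finset.mem_image]
    constructor
    · intro hx
      exact ⟨x, hx, rfl⟩
    · rintro ⟨y, hy, hxy⟩
      rw [← π.injective hxy]
      exact hy
  have keyc : ∀ π : Equiv.Perm α, π ∈ F → ∀ x, x ∈ Tᶜ → π x ∈ Uᶜ := by
    intro π hπ x hx
    rw [Finset.mem_compl] at hx ⊢
    exact fun h => hx ((key π hπ x).mpr h)
  let φ : F → (T ↪ U) × ((Tᶜ : Finset α) ↪ (Uᶜ : Finset α)) := fun π =>
    (⟨fun x => ⟨π.1 x, (key π.1 π.2 x).mp x.2⟩, fun x y h =>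
        Subtype.ext (π.1.injective (congrArg Subtype.val h))⟩,
     ⟨fun x => ⟨π.1 x, keyc π.1 π.2 x x.2⟩, fun x y h =>
        Subtype.ext (π.1.injective (congrArg Subtype.val h))⟩)
  have hφ : Function.Injective φ := by
    rintro ⟨π₁, h₁⟩ ⟨π₂, h₂⟩ h
    have h1 : ∀ x : T, π₁ x = π₂ x := fun x => by
      have := congrArg (fun p => (p.1 x : U).1) h
      simpa [φ] using this
    have h2 : ∀ x : (Tᶜ : Finset α), π₁ x = π₂ x := fun x => by
      have := congrArg (fun p => (p.2 x : (Uᶜ : Finset α)).1) h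
      simpa [φ] using this
    refine Subtype.ext (Equiv.ext fun x => ?_)
    by_cases hx : x ∈ T
    · exact h1 ⟨x, hx⟩
    · exact h2 ⟨x, Finset.mem_compl.mpr hx⟩
  have hcard := Fintype.card_le_of_injective φ hφ
  rw [Fintype.card_coe, Fintype.card_prod, Fintype.card_embedding_eq,
    Fintype.card_embedding_eq, Fintype.card_coe, Fintype.card_coe, Fintype.card_coe,
    Fintype.card_coe, Finset.card_compl, Finset.card_compl, hU,
    Nat.descFactorial_self, Nat.descFactorial_self] at hcard
  exact hcard

/-- **Type rigidity of `Z`-probes** (registered stub).  Fix a set `Z` of `k` permutations of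
`Fin n`.  For `S, T ⊆ Fin n` with `#S = s` in the window `n < 3ks ≤ 2n`, at most
`(2/3)^{⌊n/(3k²)⌋} · n!` permutations `π` are compatible with `(S, T)` (every `i ∈ S` sees `T`
through one of its `k` probe columns `π⁻¹ (ζ i)`, `ζ ∈ Z`, and every `j ∈ T` is a probe column
of a row of `S`): `#compatible · 3^{⌊n/(3k²)⌋} ≤ 2^{⌊n/(3k²)⌋} · n!`. [folklore] -/
theorem stub_zRigidity :
    ∀ (n k s : ℕ) (Z : Finset (Equiv.Perm (Fin n))) (S T : Finset (Fin n)), Z.card = k → S.card = s →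
      n < 3 * k * s → 3 * k * s ≤ 2 * n →
      ((Finset.univ : Finset (Equiv.Perm (Fin n))).filter fun π =>
          (∀ i ∈ S, ∃ ζ ∈ Z, π.symm (ζ i) ∈ T) ∧ (∀ j ∈ T, ∃ ζ ∈ Z, ∃ i ∈ S, ζ i = π j)).card * 3 ^ (n / (3 * k ^ 2)) ≤
        2 ^ (n / (3 * k ^ 2)) * n.factorial := by
  intro n k s Z S T hZ hS hlo hhi
  classical
  -- the pieces of the count
  set u : ℕ := T.card
  set f : ℕ := n / (3 * k ^ 2)
  set W : Finset (Fin n) := S.biUnion fun i => Z.image fun ζ : Equiv.Perm (Fin n) => ζ i with hW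
  set V : Finset (Finset (Fin n)) :=
    (W.powersetCard u).filter fun U => ∀ i ∈ S, ∃ ζ ∈ Z, ζ i ∈ U with hV
  set Fib : Finset (Fin n) → Finset (Equiv.Perm (Fin n)) := fun U =>
    (Finset.univ : Finset (Equiv.Perm (Fin n))).filter
      fun π : Equiv.Perm (Fin n) => T.image ⇑π = U with hFib
  set C : Finset (Equiv.Perm (Fin n)) :=
    (Finset.univ : Finset (Equiv.Perm (Fin n))).filter fun π =>
      (∀ i ∈ S, ∃ ζ ∈ Z, π.symm (ζ i) ∈ T) ∧
      (∀ j ∈ T, ∃ ζ ∈ Z, ∃ i ∈ S, ζ i = π j) with hC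
  -- (1) compatibility depends only on the image `π(T)`, which must be valid
  have hsub : C ⊆ V.biUnion Fib := by
    intro π hπ
    rw [hC, Finset.mem_filter] at hπ
    obtain ⟨-, ha, hb⟩ := hπ
    rw [Finset.mem_biUnion]
    refine ⟨T.image ⇑π, ?_, ?_⟩
    · rw [hV, Finset.mem_filter, Finset.mem_powersetCard]
      refine ⟨⟨?_, Finset.card_image_of_injective _ π.injective⟩, ?_⟩
      · intro x hx
        rw [Finset.mem_image] at hx
        obtain ⟨j, hj, rfl⟩ := hx
        obtain ⟨ζ, hζ, i, hi, h⟩ := hb j hj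
        rw [hW, Finset.mem_biUnion]
        exact ⟨i, hi, Finset.mem_image.mpr ⟨ζ, hζ, h⟩⟩
      · intro i hi
        obtain ⟨ζ, hζ, h⟩ := ha i hi
        exact ⟨ζ, hζ, Finset.mem_image.mpr ⟨_, h, π.apply_symm_apply _⟩⟩
    · rw [hFib, Finset.mem_filter]
      exact ⟨Finset.mem_univ _, rfl⟩
  -- (2) there are at most `C(ks, u)` valid images
  have hWcard : W.card ≤ k * s := by
    calc W.card ≤ ∑ i ∈ S, (Z.image fun ζ : Equiv.Perm (Fin n) => ζ i).card :=
          Finset.card_biUnion_le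
      _ ≤ ∑ _i ∈ S, k :=
          Finset.sum_le_sum fun i _ => Finset.card_image_le.trans hZ.le
      _ = k * s := by rw [Finset.sum_const, smul_eq_mul, hS, mul_comm]
  have hVcard : V.card ≤ (k * s).choose u := by
    calc V.card ≤ (W.powersetCard u).card := Finset.card_filter_le _ _
      _ = W.card.choose u := Finset.card_powersetCard _ _
      _ ≤ (k * s).choose u := Nat.choose_le_choose u hWcard
  -- (3) each fibre has at most `u! (n-u)!` elements, so `#C ≤ C(ks,u) u! (n-u)!`
  have hCcard : C.card ≤ (k * s).choose u * (u.factorial * (n - u).factorial) := by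
    calc C.card ≤ (V.biUnion Fib).card := Finset.card_le_card hsub
      _ ≤ ∑ U ∈ V, (Fib U).card := Finset.card_biUnion_le
      _ ≤ ∑ _U ∈ V, u.factorial * (n - u).factorial := by
          refine Finset.sum_le_sum fun U hU => ?_
          rw [hV, Finset.mem_filter, Finset.mem_powersetCard] at hU
          have h := card_perm_filter_image_eq_le T U hU.1.2
          rwa [Fintype.card_fin] at h
      _ = V.card * (u.factorial * (n - u).factorial) := by rw [Finset.sum_const, smul_eq_mul]
      _ ≤ (k * s).choose u * (u.factorial * (n - u).factorial) :=
          Nat.mul_le_mul_right _ hVcard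
  -- (4) if `C` is nonempty then some valid `U` exists, forcing `s ≤ ku` and `⌊n/(3k²)⌋ < u`
  rcases C.eq_empty_or_nonempty with hCe | hCne
  · rw [hCe]
    simp
  have hfu : f ≤ u := by
    obtain ⟨π, hπ⟩ := hCne
    have hπ' := hsub hπ
    rw [Finset.mem_biUnion] at hπ'
    obtain ⟨U, hUV, -⟩ := hπ'
    rw [hV, Finset.mem_filter, Finset.mem_powersetCard] at hUV
    obtain ⟨⟨-, hUcard⟩, hcov⟩ := hUV
    have hSsub : S ⊆ U.biUnion fun x => Z.image fun ζ : Equiv.Perm (Fin n) => ζ.symm x := by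
      intro i hi
      obtain ⟨ζ, hζ, h⟩ := hcov i hi
      rw [Finset.mem_biUnion]
      exact ⟨ζ i, h, Finset.mem_image.mpr ⟨ζ, hζ, ζ.symm_apply_apply i⟩⟩
    have hsku : s ≤ k * u := by
      calc s = S.card := hS.symm
        _ ≤ (U.biUnion fun x => Z.image fun ζ : Equiv.Perm (Fin n) => ζ.symm x).card :=
            Finset.card_le_card hSsub
        _ ≤ ∑ x ∈ U, (Z.image fun ζ : Equiv.Perm (Fin n) => ζ.symm x).card :=
            Finset.card_biUnion_le
        _ ≤ ∑ _x ∈ U, k :=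
            Finset.sum_le_sum fun x _ => Finset.card_image_le.trans hZ.le
        _ = k * u := by rw [Finset.sum_const, smul_eq_mul, hUcard, mul_comm]
    have hk : 0 < k := Nat.pos_of_ne_zero fun h => by simp [h] at hlo
    have hk2 : 0 < 3 * k ^ 2 := by positivity
    have hn : n < u * (3 * k ^ 2) := by
      calc n < 3 * k * s := hlo
        _ ≤ 3 * k * (k * u) := Nat.mul_le_mul_left _ hsku
        _ = u * (3 * k ^ 2) := by ring
    exact ((Nat.div_lt_iff_lt_mul hk2).mpr hn).le
  -- (5) the numerical inequality
  have hun : u ≤ n := by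
    have := Finset.card_le_univ T
    rwa [Fintype.card_fin] at this
  have hab : 3 * (k * s) ≤ 2 * n := by
    rw [← mul_assoc]
    exact hhi
  have hnum := descFactorial_mul_three_pow_le (k * s) n hab u f hfu
  calc C.card * 3 ^ f
      ≤ (k * s).choose u * (u.factorial * (n - u).factorial) * 3 ^ f :=
        Nat.mul_le_mul_right _ hCcard
    _ = (k * s).descFactorial u * 3 ^ f * (n - u).factorial := by
        rw [Nat.descFactorial_eq_factorial_mul_choose]; ring
    _ ≤ 2 ^ f * n.descFactorial u * (n - u).factorial :=
        Nat.mul_le_mul_right _ hnum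
    _ = 2 ^ f * n.factorial := by
        rw [← Nat.factorial_mul_descFactorial hun]; ring

end Summit.ValiantsHypothesis.ValiantsHypothesis.Theorems.DivisionGap.PerMultiplesHard.ZRigidity
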